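import Summits.NavierStokesRegularity.NavierStokesRegularity.Theorems.CoriolisHeadTypeIRatePressureRate
import Summits.NavierStokesRegularity.NavierStokesRegularity.Theorems.CoriolisHeadFarFieldGradientLimit
import Summits.NavierStokesRegularity.NavierStokesRegularity.Theorems.CoriolisHeadTypeIRateReduction
import HarnessLib

/-!
# CoriolisHeadTypeIRateOfGradientDecay — crux `NoCoRotatingCore` (stmt-NavierStokesRegularity-22676), line
# `far_field_constancy` v2 (skeleton 15c9a82ad206abb9), stub K1c `stub_typeIRate` — file 3/3:
# **K1c HOLDS AS SOON AS K1a COMES WITH ANY POWER GAIN ON THE GRADIENT**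

`TypeIRate.typeIRate_of_fderiv_power_decay`: let `(U, P)` be a bounded smooth rotated Leray profile
(`−νΔU + aU + a(y·∇)U + (BU − (By·∇)U) + (U·∇)U + ∇P = 0`, `div U = 0`, `ν, a > 0`, `B` skew) with the line's
K1a (scale-natural derivative decay `‖y‖‖DU‖ + ‖y‖²‖D²U‖ → 0`) and K1b's conclusion `U → b`.  IF
`‖DU(y)‖ ≤ C₁/‖y‖^{1+δ'}` beyond some radius for some `δ' > 0`, THEN `‖U(y) − b‖ ≤ K/(1 + ‖y‖)` — K1c's
conclusion.  Chain (all landed): `ΔP = −tr(DU∘DU)` gives `|ΔP| ≤ 3‖DU‖² ≤ K₂(1+‖y‖)^{−q}`,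
`q = 2 + 2min(δ', ¼) ∈ (2, 3)` (`abs_laplacian_pressure_le_sq`); `∇P → g`
(`FarFieldLimit.exists_gradient_pressure_limit`) and `g = −(ab + Bb)` (`gradient_limit_eq`, from `U → b` and the
remainder bound of `CoriolisHeadFarFieldLimitTools`); the dyadic telescoping of file 2/3 gives
`‖∇P(y) − g‖ ≤ C_P‖y‖^{1−q}`; and the TRANSPORT HALF `typeIRate_of_gradient_pressure_decay`
(`CoriolisHeadTypeIRateReduction`) turns the pressure rate into the Type-I rate along the spiral characteristics.

HONEST FRAMING.  K1c AS REGISTERED (hypothesis K1a only: `‖DU‖ = o(1/r)`) stays OPEN: its entire content is now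
LOCATED in the gap between `o(r⁻¹)` and `O(r^{−1−δ'})` for the gradient (an `O(1/r)` pressure rate would lose a
logarithm in the transport step).  For the planner (ns-idea-10): K1a ∧ K1c can be MERGED into the single crux
K1a⁺ «scale-natural derivative decay with a power gain» (K1b then follows too); the line would rest on K1a⁺ + the
Pineau–Vicol residual.  Nothing here proves `NoCoRotatingCore`, Pineau–Vicol's Conjecture 1.1 or NS regularity.

References: line card `Cruxes/NoCoRotatingCore/Lines/far_field_constancy.md` (K1c: «a bootstrap that first gains
any power closes at the rate»); B. Pineau, V. Vicol, arXiv:2607.09619 (2026), Prop. 3.1 [PineauVicol2026];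
H. Jia, V. Šverák, Invent. Math. 196 (2014) §4 [JiaSverak2014].
-/

noncomputable section

open MeasureTheory Set Function Filter Topology Metric InnerProductSpace Real
open scoped RealInnerProductSpace Laplacian ContDiff

-- the summit and its single sub-problem share the name (CONVENTIONS §1), as in every Theorems file
set_option linter.dupNamespace false

namespace Summit.NavierStokesRegularity.NavierStokesRegularity.Theorems.CoriolisHead

namespace TypeIRate

open Literature.Analysis.FluidPDE

/-! ## §5 K1c from a power gain on the gradient -/

section Profile

variable {ν a : ℝ} {B : EuclideanSpace ℝ (Fin 3) →L[ℝ] EuclideanSpace ℝ (Fin 3)}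
  {U : EuclideanSpace ℝ (Fin 3) → EuclideanSpace ℝ (Fin 3)} {P : EuclideanSpace ℝ (Fin 3) → ℝ}

/-- `|ΔP(w)| ≤ 3‖DU(w)‖²` for a rotated profile (`ΔP = −tr(DU∘DU)`, `|tr L| ≤ 3‖L‖` on `ℝ³`).
[cite: PineauVicol2026, proof of Lemma 2.1 (p. 9)] -/
theorem abs_laplacian_pressure_le_sq (hU3 : ContDiff ℝ 3 U) (hP2 : ContDiff ℝ 2 P)
    (hdiv : VectorCalculus.IsDivFree U)
    (heq : ∀ y, -(ν • (Δ U) y) + a • U y + a • fderiv ℝ U y y + (B (U y) - fderiv ℝ U y (B y)) +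
      convect U U y + gradient P y = 0) (w : EuclideanSpace ℝ (Fin 3)) :
    |(Δ P) w| ≤ 3 * ‖fderiv ℝ U w‖ ^ 2 := by
  rw [laplacian_pressure_eq_of_rotated hU3 hP2 hdiv heq w, abs_neg]
  calc |traceCLM ((fderiv ℝ U w).comp (fderiv ℝ U w))|
      ≤ 3 * ‖(fderiv ℝ U w).comp (fderiv ℝ U w)‖ := abs_traceCLM_le_three_mul_opNorm _
    _ ≤ 3 * (‖fderiv ℝ U w‖ * ‖fderiv ℝ U w‖) :=
        mul_le_mul_of_nonneg_left (ContinuousLinearMap.opNorm_comp_le _ _) (by norm_num)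
    _ = 3 * ‖fderiv ℝ U w‖ ^ 2 := by ring

/-- **The limit of `∇P` is `−(ab + Bb)`** when `U → b` (K1b) and K1a holds: `∇P + aU + BU → 0`. [folklore] -/
theorem gradient_limit_eq (hν : 0 < ν) (ha : 0 < a) (hU : ContDiff ℝ (⊤ : ℕ∞) U)
    (heq : ∀ y, -(ν • (Δ U) y) + a • U y + a • fderiv ℝ U y y + (B (U y) - fderiv ℝ U y (B y)) +
      convect U U y + gradient P y = 0)
    (hbdd : ∃ M : ℝ, ∀ y, ‖U y‖ ≤ M)
    (hdecay : ∀ ε : ℝ, 0 < ε → ∃ R : ℝ, ∀ y : EuclideanSpace ℝ (Fin 3), R ≤ ‖y‖ →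
      ‖y‖ * ‖fderiv ℝ U y‖ + ‖y‖ ^ 2 * ‖iteratedFDeriv ℝ 2 U y‖ ≤ ε)
    {b : EuclideanSpace ℝ (Fin 3)}
    (hlim : ∀ ε : ℝ, 0 < ε → ∃ R : ℝ, ∀ y : EuclideanSpace ℝ (Fin 3), R ≤ ‖y‖ → ‖U y - b‖ ≤ ε)
    {g : EuclideanSpace ℝ (Fin 3)}
    (hg : ∀ ε : ℝ, 0 < ε → ∃ R : ℝ, ∀ w : EuclideanSpace ℝ (Fin 3), R ≤ ‖w‖ → ‖gradient P w - g‖ ≤ ε) :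
    g = -(a • b + B b) := by
  obtain ⟨M, hM⟩ := hbdd
  have hM0 : 0 ≤ M := (norm_nonneg _).trans (hM 0)
  have hU2 : ContDiff ℝ 2 U := hU.of_le (by norm_cast)
  rw [← add_eq_zero_iff_eq_neg, ← norm_le_zero_iff]
  refine le_of_forall_pos_le_add fun ε hε => ?_
  rw [zero_add]
  -- three radii
  set Csys : ℝ := 3 * ν + a + ‖B‖ + M with hCsys
  have hCsys0 : 0 < Csys + 1 := by positivity
  obtain ⟨Rδ, hRδ1, hRδ⟩ := FarFieldLimit.exists_radius_decay hdecay (div_pos hε (mul_pos three_pos hCsys0))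
  have hab : 0 < a + ‖B‖ + 1 := by positivity
  obtain ⟨Rb, hRb⟩ := hlim (ε / (3 * (a + ‖B‖ + 1))) (by positivity)
  obtain ⟨Rg, hRg⟩ := hg (ε / 3) (by positivity)
  -- a far point
  set R : ℝ := max (max Rδ Rb) (max Rg 1) with hR
  have hR1 : 1 ≤ R := (le_max_right _ _).trans (le_max_right _ _)
  obtain ⟨y, hyn⟩ := exists_norm_eq (EuclideanSpace ℝ (Fin 3)) (by linarith : (0 : ℝ) ≤ R)
  have h1 := hRδ y (by rw [hyn]; exact (le_max_left _ _).trans (le_max_left _ _))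
  have hrem := FarFieldLimit.norm_gradient_add_linear_le hν.le ha.le hU2 heq hM (by positivity) hRδ1 hRδ y
    (by rw [hyn]; exact (le_max_left _ _).trans (le_max_left _ _))
  have h2 := hRb y (by rw [hyn]; exact (le_max_right _ _).trans (le_max_left _ _))
  have h3 := hRg y (by rw [hyn]; exact (le_max_left _ _).trans (le_max_right _ _))
  -- `g + ab + Bb = (g − ∇P y) + (∇P y + aUy + BUy) − (a(Uy − b) + B(Uy − b))`
  have hid : g + (a • b + B b) =
      (g - gradient P y) + (gradient P y + (a • U y + B (U y))) - (a • (U y - b) + B (U y - b)) := by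
    rw [smul_sub, map_sub]; abel
  have h4 : ‖a • (U y - b) + B (U y - b)‖ ≤ (a + ‖B‖) * ‖U y - b‖ := by
    calc ‖a • (U y - b) + B (U y - b)‖ ≤ ‖a • (U y - b)‖ + ‖B (U y - b)‖ := norm_add_le _ _
      _ ≤ a * ‖U y - b‖ + ‖B‖ * ‖U y - b‖ := by
          rw [norm_smul, Real.norm_of_nonneg ha.le]; exact add_le_add le_rfl (B.le_opNorm _)
      _ = (a + ‖B‖) * ‖U y - b‖ := by ring
  have h5 : (a + ‖B‖) * ‖U y - b‖ ≤ ε / 3 := by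
    have := mul_le_mul_of_nonneg_left h2 (by positivity : 0 ≤ a + ‖B‖)
    refine this.trans ?_
    rw [mul_div_assoc']
    rw [div_le_div_iff₀ (by positivity) three_pos]
    nlinarith [norm_nonneg B]
  have h6 : (3 * ν + a + ‖B‖ + M) * (ε / (3 * (Csys + 1))) ≤ ε / 3 := by
    rw [← hCsys, mul_div_assoc', div_le_div_iff₀ (by positivity) three_pos]
    nlinarith
  rw [hid]
  have s1 := norm_sub_le ((g - gradient P y) + (gradient P y + (a • U y + B (U y))))
    (a • (U y - b) + B (U y - b))
  have s2 := norm_add_le (g - gradient P y) (gradient P y + (a • U y + B (U y)))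
  rw [norm_sub_rev] at h3
  linarith

/-- **K1c from a power gain on the gradient (stub `stub_typeIRate` modulo K1a⁺).**  For a bounded smooth
rotated Leray profile with the line's hypotheses K1a (scale-natural derivative decay) and K1b's conclusion
`U → b`, IF the gradient decays with any power gain, `‖DU(y)‖ ≤ C₁/‖y‖^{1+δ'}` (`δ' > 0`) beyond some radius,
THEN the Type-I rate holds: `‖U(y) − b‖ ≤ K/(1 + ‖y‖)`.  Chain: `|ΔP| ≤ 3‖DU‖² ≤ K₂(1+‖y‖)^{−q}` with
`q = 2 + 2 min(δ', 1/4) ∈ (2, 3)`; `∇P → g = −(ab + Bb)` (`CoriolisHeadFarFieldGradientLimit`, `gradient_limit_eq`);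
the dyadic telescoping gives `‖∇P(y) − g‖ ≤ C_P ‖y‖^{1−q}` (`abs_fderiv_sub_inner_le`); and the transport half
`typeIRate_of_gradient_pressure_decay` (`CoriolisHeadTypeIRateReduction`) concludes.  HONEST FRAMING: K1c as
registered (no power gain) stays OPEN — its content is now located in the gap between K1a (`‖DU‖ = o(1/r)`) and a
power gain `O(r^{−1−δ'})`; nothing here proves `NoCoRotatingCore`, Pineau–Vicol's conjecture or NS regularity.
[cite: PineauVicol2026, Conj. 1.1, Prop. 3.1] -/
theorem typeIRate_of_fderiv_power_decay (hν : 0 < ν) (ha : 0 < a)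
    (hB : ∀ x, inner ℝ (B x) x = 0) (hU : ContDiff ℝ (⊤ : ℕ∞) U) (hP : ContDiff ℝ 2 P)
    (hdiv : VectorCalculus.IsDivFree U)
    (heq : ∀ y, -(ν • (Δ U) y) + a • U y + a • fderiv ℝ U y y + (B (U y) - fderiv ℝ U y (B y)) +
      convect U U y + gradient P y = 0)
    (hbdd : ∃ M : ℝ, ∀ y, ‖U y‖ ≤ M)
    (hdecay : ∀ ε : ℝ, 0 < ε → ∃ R : ℝ, ∀ y : EuclideanSpace ℝ (Fin 3), R ≤ ‖y‖ →
      ‖y‖ * ‖fderiv ℝ U y‖ + ‖y‖ ^ 2 * ‖iteratedFDeriv ℝ 2 U y‖ ≤ ε)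
    (b : EuclideanSpace ℝ (Fin 3))
    (hlim : ∀ ε : ℝ, 0 < ε → ∃ R : ℝ, ∀ y : EuclideanSpace ℝ (Fin 3), R ≤ ‖y‖ → ‖U y - b‖ ≤ ε)
    (hgradU : ∃ δ' C₁ R₁ : ℝ, 0 < δ' ∧ ∀ y : EuclideanSpace ℝ (Fin 3), R₁ ≤ ‖y‖ →
      ‖fderiv ℝ U y‖ ≤ C₁ / ‖y‖ ^ (1 + δ')) :
    ∃ K : ℝ, ∀ y : EuclideanSpace ℝ (Fin 3), ‖U y - b‖ ≤ K / (1 + ‖y‖) := by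
  obtain ⟨δ', C₁, R₁, hδ', hDU⟩ := hgradU
  have hU3 : ContDiff ℝ 3 U := hU.of_le (by norm_cast)
  have hP1 : ContDiff ℝ 1 P := hP.of_le one_le_two
  have hPinf : ContDiff ℝ ∞ P := contDiff_pressure_of_rotated hU hP1 heq
  -- the limit of the pressure gradient
  obtain ⟨g, hg⟩ := FarFieldLimit.exists_gradient_pressure_limit hν ha hB hU hP hdiv heq hbdd hdecay
  have hgb : g = -(a • b + B b) := gradient_limit_eq hν ha hU heq hbdd hdecay hlim hg
  -- exponents
  set δ₂ : ℝ := min δ' (1 / 4) with hδ₂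
  have hδ₂pos : 0 < δ₂ := lt_min hδ' (by norm_num)
  have hδ₂le : δ₂ ≤ δ' := min_le_left _ _
  have hδ₂le' : δ₂ ≤ 1 / 4 := min_le_right _ _
  set q : ℝ := 2 + 2 * δ₂ with hq
  have hq2 : 2 ≤ q := by rw [hq]; linarith
  have hq3 : q < 3 := by rw [hq]; linarith
  have hq0 : 0 ≤ q := by linarith
  -- `C₁ ≥ 0` may be assumed; radius `R₁' = max R₁ 1`
  set R₁' : ℝ := max R₁ 1 with hR₁'
  have hR₁'1 : 1 ≤ R₁' := le_max_right _ _
  have hC₁ : ∀ w : EuclideanSpace ℝ (Fin 3), R₁' ≤ ‖w‖ → ‖fderiv ℝ U w‖ ≤ max C₁ 0 / ‖w‖ ^ (1 + δ₂) := by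
    intro w hw
    have hw1 : 1 ≤ ‖w‖ := hR₁'1.trans hw
    have h := hDU w ((le_max_left _ _).trans hw)
    refine h.trans ?_
    have hpow : ‖w‖ ^ (1 + δ₂) ≤ ‖w‖ ^ (1 + δ') :=
      Real.rpow_le_rpow_of_exponent_le hw1 (by linarith)
    have hp1 : 0 < ‖w‖ ^ (1 + δ₂) := Real.rpow_pos_of_pos (by linarith) _
    have hp2 : 0 < ‖w‖ ^ (1 + δ') := Real.rpow_pos_of_pos (by linarith) _
    calc C₁ / ‖w‖ ^ (1 + δ') ≤ max C₁ 0 / ‖w‖ ^ (1 + δ') :=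
          div_le_div_of_nonneg_right (le_max_left _ _) hp2.le
      _ ≤ max C₁ 0 / ‖w‖ ^ (1 + δ₂) := div_le_div_of_nonneg_left (le_max_right _ _) hp1 hpow
  -- the gradient is bounded on the ball `‖w‖ ≤ R₁'`
  obtain ⟨D₀, hD₀⟩ := (isCompact_closedBall (0 : EuclideanSpace ℝ (Fin 3)) R₁').exists_bound_of_continuousOn
    ((hU.continuous_fderiv (by simp)).continuousOn)
  have hD₀0 : 0 ≤ D₀ := (norm_nonneg _).trans (hD₀ 0 (mem_closedBall_self (by linarith)))
  -- the global Laplacian bound `|ΔP w| ≤ K₂ / (1 + ‖w‖)^q`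
  set K₂ : ℝ := 3 * (max C₁ 0) ^ 2 * 2 ^ q + 3 * D₀ ^ 2 * (1 + R₁') ^ q with hK₂
  have hK₂0 : 0 ≤ K₂ := by positivity
  have hΔ : ∀ w : EuclideanSpace ℝ (Fin 3), |(Δ P) w| ≤ K₂ / (1 + ‖w‖) ^ q := by
    intro w
    have hsq := abs_laplacian_pressure_le_sq hU3 hP hdiv heq w
    have h1w : 0 < (1 + ‖w‖) ^ q := Real.rpow_pos_of_pos (by positivity) _
    rw [le_div_iff₀ h1w]
    by_cases hw : R₁' ≤ ‖w‖
    · -- far: `3‖DU‖² (1+‖w‖)^q ≤ 3 C₁² 2^q`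
      have hw1 : 1 ≤ ‖w‖ := hR₁'1.trans hw
      have hwpos : 0 < ‖w‖ := by linarith
      have hDw := hC₁ w hw
      have hpw : 0 < ‖w‖ ^ (1 + δ₂) := Real.rpow_pos_of_pos hwpos _
      -- `‖DU‖² ≤ C² / ‖w‖^{2+2δ₂} = C²/‖w‖^q`
      have hsq2 : ‖fderiv ℝ U w‖ ^ 2 ≤ (max C₁ 0) ^ 2 / ‖w‖ ^ q := by
        have h0 : 0 ≤ ‖fderiv ℝ U w‖ := norm_nonneg _
        have h1 : ‖fderiv ℝ U w‖ ^ 2 ≤ (max C₁ 0 / ‖w‖ ^ (1 + δ₂)) ^ 2 := pow_le_pow_left₀ h0 hDw 2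
        rw [div_pow, ← Real.rpow_natCast (‖w‖ ^ (1 + δ₂)) 2, ← Real.rpow_mul hwpos.le] at h1
        rw [hq, show (2 : ℝ) + 2 * δ₂ = (1 + δ₂) * (2 : ℕ) by push_cast; ring]
        exact h1
      -- `(1 + ‖w‖)^q ≤ 2^q ‖w‖^q`
      have h12 : (1 + ‖w‖) ^ q ≤ (2 : ℝ) ^ q * ‖w‖ ^ q := by
        rw [← Real.mul_rpow zero_le_two hwpos.le]
        exact Real.rpow_le_rpow (by positivity) (by linarith) hq0
      have hwq : 0 < ‖w‖ ^ q := Real.rpow_pos_of_pos hwpos _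
      calc |(Δ P) w| * (1 + ‖w‖) ^ q ≤ 3 * ‖fderiv ℝ U w‖ ^ 2 * (1 + ‖w‖) ^ q :=
            mul_le_mul_of_nonneg_right hsq h1w.le
        _ ≤ 3 * ((max C₁ 0) ^ 2 / ‖w‖ ^ q) * ((2 : ℝ) ^ q * ‖w‖ ^ q) :=
            mul_le_mul (mul_le_mul_of_nonneg_left hsq2 (by norm_num)) h12 h1w.le (by positivity)
        _ = 3 * (max C₁ 0) ^ 2 * 2 ^ q := by field_simp
        _ ≤ K₂ := by rw [hK₂]; nlinarith [Real.rpow_pos_of_pos (by linarith : (0:ℝ) < 1 + R₁') q]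
    · -- near: `3 D₀² (1+‖w‖)^q ≤ 3 D₀² (1 + R₁')^q`
      rw [not_le] at hw
      have hDw : ‖fderiv ℝ U w‖ ≤ D₀ := hD₀ w (mem_closedBall_zero_iff.2 hw.le)
      have hsq2 : ‖fderiv ℝ U w‖ ^ 2 ≤ D₀ ^ 2 := pow_le_pow_left₀ (norm_nonneg _) hDw 2
      have h12 : (1 + ‖w‖) ^ q ≤ (1 + R₁') ^ q := Real.rpow_le_rpow (by positivity) (by linarith) hq0
      calc |(Δ P) w| * (1 + ‖w‖) ^ q ≤ 3 * ‖fderiv ℝ U w‖ ^ 2 * (1 + ‖w‖) ^ q :=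
            mul_le_mul_of_nonneg_right hsq h1w.le
        _ ≤ 3 * D₀ ^ 2 * (1 + R₁') ^ q :=
            mul_le_mul (mul_le_mul_of_nonneg_left hsq2 (by norm_num)) h12 h1w.le (by positivity)
        _ ≤ K₂ := by rw [hK₂]; nlinarith [Real.rpow_pos_of_pos two_pos q, sq_nonneg (max C₁ 0)]
  -- the telescoping estimate
  obtain ⟨CΓ, hCΓ0, hCΓ⟩ := exists_sq_mul_norm_fderiv_newtonFar_le
  set V₁ : ℝ := (volume (ball (0 : EuclideanSpace ℝ (Fin 3)) 1)).toReal with hV₁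
  have hV₁0 : 0 ≤ V₁ := ENNReal.toReal_nonneg
  set T₁ : ℝ := 16 * CΓ * K₂ * 2 ^ q * V₁ with hT₁
  set T₂ : ℝ := 12 * CΓ * K₂ * V₁ * (20 : ℝ) ^ (3 - q) / (3 - q) with hT₂
  have h3q : 0 < 3 - q := by linarith
  have hT₁0 : 0 ≤ T₁ := by positivity
  have hT₂0 : 0 ≤ T₂ := by positivity
  set CP : ℝ := T₁ + T₂ * (8 : ℝ) ^ (q - 1) with hCP
  have hCP0 : 0 ≤ CP := by positivity
  have hrate : ∀ y : EuclideanSpace ℝ (Fin 3), 1 ≤ ‖y‖ → ‖gradient P y - g‖ ≤ CP * ‖y‖ ^ (1 - q) := by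
    intro y hy
    have hypos : 0 < ‖y‖ := by linarith
    have hyq : 0 ≤ ‖y‖ ^ (1 - q) := Real.rpow_nonneg hypos.le _
    refine FarFieldLimit.norm_le_of_forall_abs_inner_le (by positivity) fun e => ?_
    rw [inner_sub_left, inner_gradient_left]
    have h := abs_fderiv_sub_inner_le hCΓ0 hCΓ hPinf hK₂0 hq2 hq3 hΔ hg y hy e
    -- convert the two scale factors to `‖y‖^{1-q}`
    have hc1 : (1 + ‖y‖) ^ (1 - q) ≤ ‖y‖ ^ (1 - q) :=
      Real.rpow_le_rpow_of_nonpos hypos (by linarith) (by linarith)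
    have hc2 : (‖y‖ / 8) ^ (1 - q) = (8 : ℝ) ^ (q - 1) * ‖y‖ ^ (1 - q) := by
      rw [Real.div_rpow hypos.le (by norm_num), show q - 1 = -(1 - q) by ring, Real.rpow_neg (by norm_num)]
      field_simp
    refine h.trans ?_
    rw [hc2]
    have hmono : 16 * CΓ * K₂ * 2 ^ q * V₁ * (1 + ‖y‖) ^ (1 - q) ≤ T₁ * ‖y‖ ^ (1 - q) := by
      rw [hT₁]; exact mul_le_mul_of_nonneg_left hc1 (by positivity)
    have heq' : 12 * CΓ * K₂ * V₁ * (20 : ℝ) ^ (3 - q) / (3 - q) * ((8 : ℝ) ^ (q - 1) * ‖y‖ ^ (1 - q)) =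
        T₂ * (8 : ℝ) ^ (q - 1) * ‖y‖ ^ (1 - q) := by rw [hT₂]; ring
    rw [heq']
    have : (16 * CΓ * K₂ * 2 ^ q * V₁ * (1 + ‖y‖) ^ (1 - q) + T₂ * (8 : ℝ) ^ (q - 1) * ‖y‖ ^ (1 - q)) * ‖e‖
        ≤ (T₁ * ‖y‖ ^ (1 - q) + T₂ * (8 : ℝ) ^ (q - 1) * ‖y‖ ^ (1 - q)) * ‖e‖ :=
      mul_le_mul_of_nonneg_right (add_le_add hmono le_rfl) (norm_nonneg _)
    refine this.trans (le_of_eq ?_)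
    rw [hCP]; ring
  -- the pressure hypothesis of the reduction, with `δ = q − 2`
  have hPdecay : ∃ δ C R₀ : ℝ, 0 < δ ∧ ∀ y : EuclideanSpace ℝ (Fin 3), R₀ ≤ ‖y‖ →
      ‖gradient P y + (a • b + B b)‖ ≤ C / ‖y‖ ^ (1 + δ) := by
    refine ⟨q - 2, CP, 1, by linarith, fun y hy => ?_⟩
    have hypos : 0 < ‖y‖ := by linarith
    have h := hrate y hy
    rw [hgb, sub_neg_eq_add] at h
    rw [show (1 : ℝ) + (q - 2) = -(1 - q) by ring, Real.rpow_neg hypos.le, div_inv_eq_mul]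
    exact h
  exact typeIRate_of_gradient_pressure_decay hν ha hB hU heq hbdd hdecay b hPdecay

end Profile

end TypeIRate

end Summit.NavierStokesRegularity.NavierStokesRegularity.Theorems.CoriolisHead

end
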